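import Literature.Computability.AlgebraicComplexity.PerDetMultiplicityObstruction
import Mathlib.LinearAlgebra.FiniteDimensional.Lemmas
import HarnessLib

/-!
# Highest-weight EQUATIONS bound orbit-closure multiplicities from above

Topic `Computability/AlgebraicComplexity` (geometric complexity theory). Companion of
`HwvEvaluationRankBound.lean` (the LOWER bound on `mult_χ k[Δ_m[f]]` by evaluating highest-weight
vectors at points of the orbit). This file is the UPPER-bound half, in the same vocabulary
(`coordRep`, `orbitVanishingIdeal`, `orbitCoordRep`, `highestWeightSpace`, `orbitMultiplicity`,
`plethysmCoeff` — files `OrbitCoordinateRing.lean`, `GLHighestWeight.lean`, `SchurWeylPlethysm.lean`):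
highest-weight vectors of weight `χ` among the polynomial functions on `Sym^m (k^σ)` that VANISH on
the orbit `GL · f` ("equations of type `χ` for the orbit closure") lower the multiplicity of `χ` in
the coordinate ring `k[Δ_m[f]] = k[Sym^m] ⧸ I(GL · f)`, one for one:

  `mult_χ k[Δ_m[f]] + dim (HWV_χ(k[Sym^m]) ∩ I(GL · f)) = a_χ := dim HWV_χ(k[Sym^m])`

(`orbitMultiplicity_add_finrank_inf_eq_plethysmCoeff`; characteristic zero, `m ≠ 0`). This is the
identity behind Bürgisser–Ikenmeyer, STOC 2013, (5.1)–(5.2): "A sufficient criterion for the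
existence of a HWV of weight `λ^*` in the vanishing ideal `I(GL_{n²} det_n)` is given by
`pl_λ(d[n]) > sk(n×d; λ)`, since `mult_{λ^*}(I(GL_{n²} det_n)) ≥ pl_λ(d[n]) − sk(n×d; λ)`"
(`plethysmCoeff_le_symKroneckerCoeffRect_add_finrank`, using the tree's PROVED bound
`mult_{λ^*} k[Δ(det_m)] ≤ sk(λ, m×d)`, `orbitMultiplicity_det_le_symKroneckerCoeffRect`), and behind
Dörfler–Ikenmeyer–Panova, SIAGA 4 (2020), §2 eq. (2.2) / §5 ("`mult_λ(X) = dim HWV_λ(ℂ[X])`", the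
restriction `HWV_λ(ℂ[A]_d) ↠ HWV_λ(ℂ[X]_d)` is a surjection whose kernel consists of the
highest-weight vectors vanishing on `X`). The mechanism is the tree's
`map_highestWeightSpace_eq_of_surjective` (highest-weight vectors lift along the `GL`-equivariant
quotient map out of the completely reducible `k[Sym^m]`, `isSemisimpleRepresentation_coordRep`)
plus rank–nullity on the restriction of the quotient map to `HWV_χ(k[Sym^m])`, which is
finite-dimensional for `m ≠ 0` (`finiteDimensional_highestWeightSpace_coordRep_holds`).

Consequences recorded for the GCT multiplicity-obstruction engine (cell `pub-gct`, bundle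
papers/PneNP/gct-obstructions; honest framing: rung-1 multiplicity-obstruction search for permanent
versus determinant at small `(n, m)`, no claim about VP ≠ VNP or P ≠ NP):
* `orbitMultiplicity_add_le_plethysmCoeff_of_linearIndependent`: `s` linearly independent
  highest-weight equations of weight `χ` give `mult_χ k[Δ_m[f]] + s ≤ a_χ`;
* `orbitMultiplicity_lt_plethysmCoeff_of_mem_orbitVanishingIdeal`: one nonzero equation gives
  `mult_χ < a_χ`;
* `plethysmCoeff_le_symKroneckerCoeffRect_add_finrank` (BI13 (5.2) for `det_m`);
* `PerDetMultiplicityObstructionAt.of_idealHwv`: the shape of a certificate whose det side is an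
  exhibited (or cited) set of `s` independent equations of type `λ` for `Δ(det_m)` and whose
  permanent side is an evaluation rank `r` with `a_λ < r + s` — e.g. Landsberg–Manivel–Ressayre,
  Comment. Math. Helv. 88 (2013), Thm. 1.1.2 (1) and §3.2 (p. 476): for `m = 3`, `d = 12`,
  `λ = (19,7,2,2,2,2,2)` one copy of `S_λ` (`a_λ = 6`) lies in the ideal of `Δ(det_3)`, so `s = 1`
  and an evaluation rank `r = 6` at the permanent would be a multiplicity obstruction `6 > 5`
  (no such evaluation is asserted here).

## References
* [BurgisserIkenmeyer2013] P. Bürgisser, C. Ikenmeyer, *Explicit lower bounds via geometric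
  complexity theory*, STOC 2013 = arXiv:1210.8368, §5, (5.1)–(5.2).
* [DorflerIkenmeyerPanova2020] J. Dörfler, C. Ikenmeyer, G. Panova, *On geometric complexity
  theory: multiplicity obstructions are stronger than occurrence obstructions*, SIAM J. Appl.
  Algebra Geom. 4 (2020) = arXiv:1901.04576, §2 (2.2), §5.
* [BLMW2011] P. Bürgisser, J. M. Landsberg, L. Manivel, J. Weyman, *An overview of mathematical
  issues arising in the geometric complexity theory approach to VP ≠ VNP*, SIAM J. Comput. 40
  (2011), §4.4, §5.2.
* [LandsbergManivelRessayre2013] J. M. Landsberg, L. Manivel, N. Ressayre, *Hypersurfaces with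
  degenerate duals and the geometric complexity theory program*, Comment. Math. Helv. 88 (2013)
  469–484, Thm. 1.1.2, §3.2.
-/

noncomputable section

open MvPolynomial

namespace Literature.Computability.AlgebraicComplexity

open _root_.Literature.NumberTheory.DiophantineGeometry

section General

variable {σ k : Type*} [Fintype σ] [LinearOrder σ] [Field k]

/-- **Multiplicity plus number of independent highest-weight equations equals the plethysm
coefficient.** For a form `f`, `m ≠ 0`, characteristic zero, and a weight `χ`:
`mult_χ k[Δ_m[f]] + dim_k (HWV_χ(k[Sym^m (k^σ)]) ∩ I(GL · f)) = a_χ`, where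
`a_χ = plethysmCoeff k σ m χ = dim HWV_χ(k[Sym^m])`. Proof: the quotient map
`k[Sym^m] ↠ k[Δ_m[f]]` is `GL`-equivariant and `k[Sym^m]` is completely reducible, so it maps
`HWV_χ(k[Sym^m])` ONTO `HWV_χ(k[Δ_m[f]])` (`map_highestWeightSpace_eq_of_surjective`); its kernel on
`HWV_χ(k[Sym^m])` is the intersection with the vanishing ideal; rank–nullity.
Dörfler–Ikenmeyer–Panova 2020 §2 (2.2) and §5; Bürgisser–Ikenmeyer 2013 (5.1)–(5.2).
[cite: DorflerIkenmeyerPanova2020, §5] -/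
theorem orbitMultiplicity_add_finrank_inf_eq_plethysmCoeff [CharZero k] (f : MvPolynomial σ k)
    {m : ℕ} (hm : m ≠ 0) (χ : Weight σ) :
    orbitMultiplicity k f m χ +
        Module.finrank k ↥(highestWeightSpace (coordRep σ k m) χ ⊓
          (orbitVanishingIdeal f m).restrictScalars k) =
      plethysmCoeff k σ m χ := by
  classical
  haveI : Infinite k := CharZero.infinite k
  haveI : FiniteDimensional k (highestWeightSpace (coordRep σ k m) χ) :=
    finiteDimensional_highestWeightSpace_coordRep_holds hm χ
  -- the quotient map as an intertwining map `k[Sym^m] → k[Δ_m[f]]`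
  let π : (coordRep σ k m).IntertwiningMap (orbitCoordRep f m) :=
    ⟨(Ideal.Quotient.mkₐ k (orbitVanishingIdeal f m)).toLinearMap,
      fun _ => LinearMap.ext fun _ => rfl⟩
  have hmap : (highestWeightSpace (coordRep σ k m) χ).map π.toLinearMap =
      highestWeightSpace (orbitCoordRep f m) χ :=
    map_highestWeightSpace_eq_of_surjective π (Ideal.Quotient.mkₐ_surjective k _)
      (isSemisimpleRepresentation_coordRep m) χ
  -- restrict `π` to the highest-weight space and apply rank–nullity
  let g : ↥(highestWeightSpace (coordRep σ k m) χ) →ₗ[k] OrbitCoordRing f m :=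
    π.toLinearMap.domRestrict (highestWeightSpace (coordRep σ k m) χ)
  have hrange : LinearMap.range g = highestWeightSpace (orbitCoordRep f m) χ := by
    rw [LinearMap.range_domRestrict, hmap]
  have hker : LinearMap.ker g =
      (highestWeightSpace (coordRep σ k m) χ ⊓ (orbitVanishingIdeal f m).restrictScalars k).comap
        (highestWeightSpace (coordRep σ k m) χ).subtype := by
    ext x
    simp only [LinearMap.mem_ker, Submodule.mem_comap, Submodule.coe_subtype, Submodule.mem_inf,
      Submodule.restrictScalars_mem, g, LinearMap.domRestrict_apply]
    change Ideal.Quotient.mkₐ k (orbitVanishingIdeal f m) (x : MvPolynomial (DegIdx σ m) k) = 0 ↔ _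
    rw [Ideal.Quotient.mkₐ_eq_mk, Ideal.Quotient.eq_zero_iff_mem]
    exact ⟨fun hx => ⟨x.2, hx⟩, fun hx => hx.2⟩
  have hrn := LinearMap.finrank_range_add_finrank_ker g
  rw [hrange, hker, (Submodule.comapSubtypeEquivOfLe inf_le_left).finrank_eq] at hrn
  exact hrn

/-- **Independent highest-weight equations bound the multiplicity from above**: if
`F₀, …, F_{s-1}` are linearly independent highest-weight vectors of weight `χ` in `k[Sym^m (k^σ)]`
all vanishing on the orbit `GL · f` (`F_i ∈ I(GL · f)`), then `mult_χ k[Δ_m[f]] + s ≤ a_χ`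
(`m ≠ 0`, characteristic zero). Dörfler–Ikenmeyer–Panova 2020 §5; Bürgisser–Ikenmeyer 2013 (5.2).
[cite: DorflerIkenmeyerPanova2020, §5] -/
theorem orbitMultiplicity_add_le_plethysmCoeff_of_linearIndependent [CharZero k]
    {f : MvPolynomial σ k} {m : ℕ} (hm : m ≠ 0) {χ : Weight σ} {s : ℕ}
    (F : Fin s → MvPolynomial (DegIdx σ m) k)
    (hF : ∀ i, F i ∈ highestWeightSpace (coordRep σ k m) χ)
    (hI : ∀ i, F i ∈ orbitVanishingIdeal f m) (hli : LinearIndependent k F) :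
    orbitMultiplicity k f m χ + s ≤ plethysmCoeff k σ m χ := by
  classical
  haveI : Infinite k := CharZero.infinite k
  haveI : FiniteDimensional k (highestWeightSpace (coordRep σ k m) χ) :=
    finiteDimensional_highestWeightSpace_coordRep_holds hm χ
  rw [← orbitMultiplicity_add_finrank_inf_eq_plethysmCoeff f hm χ]
  apply Nat.add_le_add_left
  haveI : FiniteDimensional k ↥(highestWeightSpace (coordRep σ k m) χ ⊓
      (orbitVanishingIdeal f m).restrictScalars k) :=
    Submodule.finiteDimensional_of_le inf_le_left
  -- the `F i` as vectors of the intersection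
  let w : Fin s → ↥(highestWeightSpace (coordRep σ k m) χ ⊓
      (orbitVanishingIdeal f m).restrictScalars k) := fun i => ⟨F i, hF i, hI i⟩
  have hw : LinearIndependent k w :=
    LinearIndependent.of_comp (Submodule.subtype _) (by simpa [w, Function.comp_def] using hli)
  simpa using hw.fintype_card_le_finrank

/-- **One nonzero highest-weight equation makes the multiplicity drop below the plethysm
coefficient**: `F ≠ 0`, `F ∈ HWV_χ(k[Sym^m])`, `F ∈ I(GL · f)` give `mult_χ k[Δ_m[f]] < a_χ`
(`m ≠ 0`, characteristic zero). This is how a module "in the ideal" of an orbit closure is used on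
the SMALLER side of a multiplicity comparison (e.g. Landsberg–Manivel–Ressayre 2013 Thm. 1.1.2 (1),
§3.2 for `Δ(det_3)` in degree 12). Dörfler–Ikenmeyer–Panova 2020 §5.
[cite: DorflerIkenmeyerPanova2020, §5] -/
theorem orbitMultiplicity_lt_plethysmCoeff_of_mem_orbitVanishingIdeal [CharZero k]
    {f : MvPolynomial σ k} {m : ℕ} (hm : m ≠ 0) {χ : Weight σ}
    {F : MvPolynomial (DegIdx σ m) k} (hF : F ∈ highestWeightSpace (coordRep σ k m) χ)
    (hI : F ∈ orbitVanishingIdeal f m) (hF0 : F ≠ 0) :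
    orbitMultiplicity k f m χ < plethysmCoeff k σ m χ := by
  have hli : LinearIndependent k (fun _ : Fin 1 => F) := linearIndependent_unique_iff.mpr hF0
  have h := orbitMultiplicity_add_le_plethysmCoeff_of_linearIndependent hm (fun _ : Fin 1 => F)
    (fun _ => hF) (fun _ => hI) hli
  omega

/-- **Upper-bound direction of "multiplicity = plethysm − equations"**: the multiplicity never
exceeds the plethysm coefficient minus the number of independent highest-weight equations; in
particular (with `s = 0`) `mult_χ k[Δ_m[f]] ≤ a_χ` (BLMW 2011 §4.4/§5.2, the tree's
`orbitMultiplicity_le_plethysmCoeff_holds`, recovered). [cite: BLMW2011, §5.2] -/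
theorem orbitMultiplicity_le_plethysmCoeff_sub_finrank [CharZero k] (f : MvPolynomial σ k)
    {m : ℕ} (hm : m ≠ 0) (χ : Weight σ) :
    orbitMultiplicity k f m χ ≤ plethysmCoeff k σ m χ -
      Module.finrank k ↥(highestWeightSpace (coordRep σ k m) χ ⊓
        (orbitVanishingIdeal f m).restrictScalars k) := by
  have h := orbitMultiplicity_add_finrank_inf_eq_plethysmCoeff f hm χ
  omega

end General

section Determinant

variable {k : Type} [Field k]

/-- **Bürgisser–Ikenmeyer 2013, (5.2), for `det_m`** (their `n`): the space of highest-weight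
vectors of weight `λ^*` in `k[Sym^m (k^{m²})]` that vanish on `GL_{m²} · det_m` has dimension at
least `a_λ(d[m]) − sk(λ, m×d)` — stated additively: `a_λ ≤ sk + dim (HWV_{λ^*} ∩ I(GL · det_m))`
(`ℓ(λ) ≤ m²`, `m ≠ 0`, characteristic zero). "A sufficient criterion for the existence of a HWV
of weight `λ^*` in the vanishing ideal `I(GL_{n²} det_n)` is given by `pl_λ(d[n]) > sk(n×d; λ)`,
since `mult_{λ^*}(I(GL_{n²} det_n)) ≥ pl_λ(d[n]) − sk(n×d; λ)`." From
`orbitMultiplicity_add_finrank_inf_eq_plethysmCoeff` and the tree's PROVED det-side bound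
`orbitMultiplicity_det_le_symKroneckerCoeffRect` (BLMW 2011 Prop. 5.2.1 (5.2.7)).
[cite: BurgisserIkenmeyer2013, §5 (5.2)] -/
theorem plethysmCoeff_le_symKroneckerCoeffRect_add_finrank [CharZero k] {m d : ℕ} [NeZero m]
    (lam : Nat.Partition (m * d)) (hlam : lam.parts.card ≤ m * m) :
    plethysmCoeff k (MatIdx m) m (Weight.dualOfPartition (m * m) lam).toMatIdx ≤
      symKroneckerCoeffRect k m d lam +
        Module.finrank k ↥(highestWeightSpace (coordRep (MatIdx m) k m)
            (Weight.dualOfPartition (m * m) lam).toMatIdx ⊓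
          (orbitVanishingIdeal (detFormLex k m) m).restrictScalars k) := by
  have h := orbitMultiplicity_add_finrank_inf_eq_plethysmCoeff (detFormLex k m) (NeZero.ne m)
    ((Weight.dualOfPartition (m * m) lam).toMatIdx : Weight (MatIdx m))
  have hsk := orbitMultiplicity_det_le_symKroneckerCoeffRect k m lam hlam
  omega

/-- **Existence of a highest-weight equation for `Δ(det_m)` from `a_λ > sk`** (Bürgisser–Ikenmeyer
2013 (5.2), the criterion defining Ikenmeyer's "obstruction candidates", thesis 2012 (8.1.1) and
App. A.1): if `sk(λ, m×d) < a_λ(d[m])` then some nonzero highest-weight vector of weight `λ^*` in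
`k[Sym^m (k^{m²})]` vanishes on `GL_{m²} · det_m`. [cite: BurgisserIkenmeyer2013, §5 (5.2)] -/
theorem exists_hwv_mem_orbitVanishingIdeal_det_of_symKroneckerCoeffRect_lt [CharZero k] {m d : ℕ}
    [NeZero m] (lam : Nat.Partition (m * d)) (hlam : lam.parts.card ≤ m * m)
    (hlt : symKroneckerCoeffRect k m d lam <
      plethysmCoeff k (MatIdx m) m (Weight.dualOfPartition (m * m) lam).toMatIdx) :
    ∃ F : MvPolynomial (DegIdx (MatIdx m) m) k, F ≠ 0 ∧
      F ∈ highestWeightSpace (coordRep (MatIdx m) k m) (Weight.dualOfPartition (m * m) lam).toMatIdx ∧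
      F ∈ orbitVanishingIdeal (detFormLex k m) m := by
  have h := plethysmCoeff_le_symKroneckerCoeffRect_add_finrank (k := k) lam hlam
  have hpos : 0 < Module.finrank k ↥(highestWeightSpace (coordRep (MatIdx m) k m)
        (Weight.dualOfPartition (m * m) lam).toMatIdx ⊓
      (orbitVanishingIdeal (detFormLex k m) m).restrictScalars k) := by omega
  haveI := Module.nontrivial_of_finrank_pos hpos
  obtain ⟨⟨F, hFH, hFI⟩, hF0⟩ := exists_ne (0 : ↥(highestWeightSpace (coordRep (MatIdx m) k m)
        (Weight.dualOfPartition (m * m) lam).toMatIdx ⊓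
      (orbitVanishingIdeal (detFormLex k m) m).restrictScalars k))
  refine ⟨F, ?_, hFH, hFI⟩
  intro h0
  apply hF0
  exact Subtype.ext h0

/-- **Certificate shape with an ideal-side input** (characteristic zero): from `n ≤ m`,
`ℓ(λ) ≤ m²`, `s` linearly independent highest-weight vectors of weight `λ^*` in `k[Sym^m (k^{m²})]`
vanishing on `GL_{m²} · det_m` (equations of type `λ` for `Δ(det_m)` — exhibited, or supplied by a
cited theorem such as Landsberg–Manivel–Ressayre 2013 Thm. 1.1.2 (1) for `m = 3`, `d = 12`,
`λ = (19,7,2^5)`, `s = 1`), and an evaluation rank `r ≤ mult_{λ^*} k[Δ(X₀₀^{m-n} per_n)]`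
(`HwvEvaluationRankBound.lean`) with `a_λ(d[m]) < r + s`, the pair `(det_m, padded per_n)` carries a
multiplicity obstruction at `(n, m, d, λ)`: `mult_det ≤ a − s < r ≤ mult_per`.
Dörfler–Ikenmeyer–Panova 2020 §5 (multiplicities from explicit highest-weight vectors on both
sides). [cite: DorflerIkenmeyerPanova2020, §5] -/
theorem PerDetMultiplicityObstructionAt.of_idealHwv [CharZero k] {n m d : ℕ} [NeZero m]
    {lam : Nat.Partition (m * d)} (hnm : n ≤ m) (hlam : lam.parts.card ≤ m * m) {s r : ℕ}
    (F : Fin s → MvPolynomial (DegIdx (MatIdx m) m) k)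
    (hF : ∀ i, F i ∈ highestWeightSpace (coordRep (MatIdx m) k m)
      (Weight.dualOfPartition (m * m) lam).toMatIdx)
    (hI : ∀ i, F i ∈ orbitVanishingIdeal (detFormLex k m) m) (hli : LinearIndependent k F)
    (ha : plethysmCoeff k (MatIdx m) m (Weight.dualOfPartition (m * m) lam).toMatIdx < r + s)
    (hr : r ≤ orbitMultiplicity k (paddedPerFormLex k n m) m
      (Weight.dualOfPartition (m * m) lam).toMatIdx) :
    PerDetMultiplicityObstructionAt (k := k) n m d lam := by
  refine ⟨hlam, hnm, ?_⟩
  have h := orbitMultiplicity_add_le_plethysmCoeff_of_linearIndependent (NeZero.ne m) F hF hI hli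
  change orbitMultiplicity k (detFormLex k m) m _ < orbitMultiplicity k (paddedPerFormLex k n m) m _
  omega

end Determinant

end Literature.Computability.AlgebraicComplexity
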